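import Literature.IUT.HodgeTheaters.Cor53iFcircHBOfBrigidKummer
import Literature.IUT.HodgeTheaters.GlobalFrobenioidsPushCarrierGaloisRich
import HarnessLib

/-!
# Layer-5 certificate v0.25 — BLOCK I over BUILT Literature modules only: [IUTchI] Cor 5.3 (i) «respectively `⊚`» at the record carrier
# `†ℱ^⊚ → †𝒟^⊚ = ℬ(H)⁰` with the 𝔹-RATIO binder `hB⊚` DISCHARGED along a GALOIS-RICH base morphism — `hker⊚` and descend-injectivity
# modulo {`hZ`, `hS`} only (abc-iut-L5-lead gen 11 RULINGS #190 (2) «V25 BlocksI (C-53i⊚)»; CERT-L5 R73 holder abc-iut-L5-t16 gen 13;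
# plan/L5/LAYER5-CERT-SPEC.md §7)

PROOF-ONLY (no `def`, no `instance`, no `axiom`, no `sorry`, no `notation`); NO `Conditional` import (architecture-neutral).  Every theorem
is a landed Literature theorem VERBATIM (section variables spelled in), proof BY NAME — one call each, from abc-iut-L5-t11's ⊚-knit
★ p542877 `Cor53iFcircHBOfBrigidKummer` (row «HBCIRC-PUSH»: (⊚-1) ★ `whisker_unitsFamily_apply_eq_self_of_iso_galoisRich` over abc-iut-L5-t16's
classical rigidity ★ p532034, (⊚-2) knit):
* (C-53i⊚′-ker) `layer5_disch_cor53i_v25_fcirc_rigidOverBase (𝓕) (hZ) (hS)` := `Cor53.fcirc_rigidOverBase_of_galoisRich`: `hker⊚` — every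
  self-equivalence of `†ℱ^⊚` over the identity of `†𝒟^⊚` is `≅ 𝟭` — DISPLAYED binders exactly {`hZ : IsSlimGroup H` (side), `hS` = «the base
  morphism `𝓕.baseMor ⋙ 𝓕.identify ⋙ galoisSubextOfFinite` is isomorphic to a GALOIS-RICH whiskering `S′` over some `c₀`» ((G1) cover ·
  (G2) directed by inclusions · (G3) Galois arrows over `K₀ := (S′ c₀).L`; RULINGS #182 hypothesis class, INTERFACE FREEZE 15:14Z)};
  v0.22's (C-53i⊚) displayed {hZ, hB⊚, hdesc⊚, hNU} — here hB⊚ is DISCHARGED (replaced by the geometric condition hS), hdesc⊚/hNU belong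
  to the surjectivity half and are not displayed in this injectivity conjunct;
* (C-53i⊚′-inj) `layer5_disch_cor53i_v25_fcirc_descend_injective (𝓕) (hZ) (hS)` := `Cor53.fcirc_descend_injective_of_galoisRich`:
  `Aut(†ℱ^⊚) → Aut(†𝒟^⊚)` injective, same binders.
* (C-53i⊚″-ker) `layer5_disch_cor53i_v25_fcirc_rigidOverBase_pushCarrier (F) (H) (ι) (hc) (ho) (hZ) (𝓕)` :=
  `Cor53.fcirc_rigidOverBase_of_pushCarrier` (abc-iut-L5-t4's (⊚-3) knit ★ `GlobalFrobenioidsPushCarrierGaloisRich`): AT THE PUSH CARRIER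
  `toBase0 := baseToCoset H ⋙ CosetCat.push ι ho ⋙ cosetToBase G_F` («the natural morphism `†𝒟^⊚ → †𝒟^⊛`», `ι : H →* G_F` continuous and
  open) `hS` is DISCHARGED ⇒ `hker⊚` modulo {`hZ : IsSlimGroup H`} ONLY;
* (C-53i⊚″-inj) `layer5_disch_cor53i_v25_fcirc_descend_injective_pushCarrier (…)` := `Cor53.fcirc_descend_injective_of_pushCarrier`, same.
HONEST NOTE (RULINGS #173 (3), of record): at a DEGENERATE `toBase0` (not Galois-rich) hB⊚ is refutable-as-typed; hS is OUR repaired binder;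
the push carrier is OUR model of the genuine `†𝒟^⊚ → †𝒟^⊛`.  CENSUS delta for §7 (the lead's booking): display: (C-53i⊚) injectivity half
re-displayed with binder set {hZ, hS} (hB⊚ dropped, hS added) and, at the push carrier, with {hZ} only · +2 descend-injective conjuncts;
CONE/FACT unchanged.
S. Mochizuki, *Inter-universal Teichmüller theory I* [cite: Mochizuki2012] (D-0012 claim key; series status DISPUTED): Cor 5.3 (i) p. 144;
Ex 5.1 (iii)/(v) pp. 125–128.  HONEST FRAMING: a CERT conjunct DISPLAYS its binders, it does not discharge them; nothing here asserts that abc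
is proved or refuted or takes a side on [IUTchIII] Cor. 3.12; typed ≠ inhabited ≠ discharged; indexed ≠ endorsed.
-/

namespace Summit.ABC.IUTFork.Conditional

open CategoryTheory Opposite Literature.IUT.HodgeTheaters
open Literature.AnabelianGeometry.SemiGraphs Literature.AlgebraicGeometry.Frobenioids
open Literature.AlgebraicGeometry.Frobenioids.QuasiTemperoid

noncomputable section BlocksIV25

/-- **(C-53i⊚′-ker) `hker⊚` at the record carrier `†ℱ^⊚ → †𝒟^⊚ = ℬ(H)⁰`, `hB⊚` DISCHARGED along a Galois-rich base morphism** :=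
abc-iut-L5-t11's ★ `Cor53.fcirc_rigidOverBase_of_galoisRich` (p542877).  DISPLAYED binders exactly {`hZ : IsSlimGroup H`, `hS` (Galois-rich,
RULINGS #182)}. [cite: Mochizuki2012, IUTchI Cor 5.3 (i) p.144] [claim: Mochizuki2012, status: disputed] -/
theorem layer5_disch_cor53i_v25_fcirc_rigidOverBase
    {F : Type} [Field F] [NumberField F] {H : ProfiniteGrp.{0}} {toBase0 : BaseCat H ⥤ BaseCat (absGalGrp F)}
    (𝓕 : GlobalFrobenioid (GlobalDivisorData.arith F) (BaseCat H) toBase0) (hZ : IsSlimGroup H)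
    (hS : ∃ (S' : BaseCat H ⥤ FinSubextCat F (Fbar F)) (c₀ : BaseCat H)
      (_ : ((𝓕.baseMor ⋙ 𝓕.identify.functor) ⋙ galoisSubextOfFinite F) ≅ S'),
      (∀ u : Fbar F, ∃ c : BaseCat H, u ∈ (S'.obj c).L) ∧
      (∀ c₁ c₂ : BaseCat H, ∃ (c₃ : BaseCat H) (g₁ : c₃ ⟶ c₁) (g₂ : c₃ ⟶ c₂),
        (∀ y : (S'.obj c₁).L, (((S'.map g₁).toAlgHom y : (S'.obj c₃).L) : Fbar F) = y) ∧
        (∀ y : (S'.obj c₂).L, (((S'.map g₂).toAlgHom y : (S'.obj c₃).L) : Fbar F) = y)) ∧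
      (∀ (σ : Fbar F ≃ₐ[(S'.obj c₀).L] Fbar F) (u : Fbar F), ∃ (c c' : BaseCat H) (g : c' ⟶ c),
        u ∈ (S'.obj c).L ∧ ∀ y : (S'.obj c).L, (((S'.map g).toAlgHom y : (S'.obj c').L) : Fbar F) = σ y)) :
    CatIsomorphism.RigidOverBase 𝓕.fcircBase :=
  Cor53.fcirc_rigidOverBase_of_galoisRich 𝓕 hZ hS

/-- **(C-53i⊚′-inj) injectivity of `Aut(†ℱ^⊚) → Aut(†𝒟^⊚)` at the record carrier, same binders {`hZ`, `hS`}** := ★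
`Cor53.fcirc_descend_injective_of_galoisRich` (p542877). [cite: Mochizuki2012, IUTchI Cor 5.3 (i) p.144] [claim: Mochizuki2012, status: disputed] -/
theorem layer5_disch_cor53i_v25_fcirc_descend_injective
    {F : Type} [Field F] [NumberField F] {H : ProfiniteGrp.{0}} {toBase0 : BaseCat H ⥤ BaseCat (absGalGrp F)}
    (𝓕 : GlobalFrobenioid (GlobalDivisorData.arith F) (BaseCat H) toBase0) (hZ : IsSlimGroup H)
    (hS : ∃ (S' : BaseCat H ⥤ FinSubextCat F (Fbar F)) (c₀ : BaseCat H)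
      (_ : ((𝓕.baseMor ⋙ 𝓕.identify.functor) ⋙ galoisSubextOfFinite F) ≅ S'),
      (∀ u : Fbar F, ∃ c : BaseCat H, u ∈ (S'.obj c).L) ∧
      (∀ c₁ c₂ : BaseCat H, ∃ (c₃ : BaseCat H) (g₁ : c₃ ⟶ c₁) (g₂ : c₃ ⟶ c₂),
        (∀ y : (S'.obj c₁).L, (((S'.map g₁).toAlgHom y : (S'.obj c₃).L) : Fbar F) = y) ∧
        (∀ y : (S'.obj c₂).L, (((S'.map g₂).toAlgHom y : (S'.obj c₃).L) : Fbar F) = y)) ∧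
      (∀ (σ : Fbar F ≃ₐ[(S'.obj c₀).L] Fbar F) (u : Fbar F), ∃ (c c' : BaseCat H) (g : c' ⟶ c),
        u ∈ (S'.obj c).L ∧ ∀ y : (S'.obj c).L, (((S'.map g).toAlgHom y : (S'.obj c').L) : Fbar F) = σ y)) :
    Function.Injective (CatIsomorphism.descend
      (GlobalFrobenioid.hasUnder_and_underUnique_fcircBase_arith_baseCat 𝓕 𝓕 hZ hZ).1
      (GlobalFrobenioid.hasUnder_and_underUnique_fcircBase_arith_baseCat 𝓕 𝓕 hZ hZ).2) :=
  Cor53.fcirc_descend_injective_of_galoisRich 𝓕 hZ hS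

/-- **(C-53i⊚″-ker) `hker⊚` AT THE PUSH CARRIER `†𝒟^⊚ = ℬ(H)⁰ → ℬ(G_F)⁰` along `CosetCat.push ι` (`ι : H →* G_F` continuous and open),
modulo {`hZ : IsSlimGroup H`} ONLY** := abc-iut-L5-t4's ★ `Cor53.fcirc_rigidOverBase_of_pushCarrier` (`hS` discharged by (⊚-3) FILE A/B).
[cite: Mochizuki2012, IUTchI Cor 5.3 (i) p.144] [claim: Mochizuki2012, status: disputed] -/
theorem layer5_disch_cor53i_v25_fcirc_rigidOverBase_pushCarrier
    (F : Type) [Field F] [NumberField F] (H : ProfiniteGrp.{0}) (ι : H →* GalFbar F) (hc : Continuous ι) (ho : IsOpenMap ι)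
    (hZ : IsSlimGroup H)
    (𝓕 : GlobalFrobenioid (GlobalDivisorData.arith F) (BaseCat H)
      (baseToCoset H ⋙ CosetCat.push ι ho ⋙ cosetToBase (absGalGrp F))) :
    CatIsomorphism.RigidOverBase 𝓕.fcircBase :=
  Cor53.fcirc_rigidOverBase_of_pushCarrier F H ι hc ho hZ 𝓕

/-- **(C-53i⊚″-inj) injectivity of `Aut(†ℱ^⊚) → Aut(†𝒟^⊚)` AT THE PUSH CARRIER, modulo {`hZ`} ONLY** := ★
`Cor53.fcirc_descend_injective_of_pushCarrier`. [cite: Mochizuki2012, IUTchI Cor 5.3 (i) p.144] [claim: Mochizuki2012, status: disputed] -/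
theorem layer5_disch_cor53i_v25_fcirc_descend_injective_pushCarrier
    (F : Type) [Field F] [NumberField F] (H : ProfiniteGrp.{0}) (ι : H →* GalFbar F) (hc : Continuous ι) (ho : IsOpenMap ι)
    (hZ : IsSlimGroup H)
    (𝓕 : GlobalFrobenioid (GlobalDivisorData.arith F) (BaseCat H)
      (baseToCoset H ⋙ CosetCat.push ι ho ⋙ cosetToBase (absGalGrp F))) :
    Function.Injective (CatIsomorphism.descend
      (GlobalFrobenioid.hasUnder_and_underUnique_fcircBase_arith_baseCat 𝓕 𝓕 hZ hZ).1
      (GlobalFrobenioid.hasUnder_and_underUnique_fcircBase_arith_baseCat 𝓕 𝓕 hZ hZ).2) :=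
  Cor53.fcirc_descend_injective_of_pushCarrier F H ι hc ho hZ 𝓕

end BlocksIV25

end Summit.ABC.IUTFork.Conditional

/-! ### Build-lane export guard (ops-buildfix bf1-g30, 2026-08-28; G11b-3 recipe v2 as in `GelbartRogawski1991/UnitaryDualPairSeesawCharacter`):
the theorems of this file carry very large dependent telescopes; at `.olean` export Lean 4.32's library-suggestion indexers fold over
every local theorem statement and do not finish within the build lane's one-hour clock (measured on a farm node: `lean -o` > 1 500 s, plain
elaboration ≈ 20 s). ONE file-final `local` `[implicit_reducible]` keeps them out of that premise index (inert for Meta and the kernel on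
theorems; no definition is tagged; statements and proofs unchanged). -/
set_option allowUnsafeReducibility true in
attribute [local implicit_reducible]
  _root_.Summit.ABC.IUTFork.Conditional.layer5_disch_cor53i_v25_fcirc_rigidOverBase
  _root_.Summit.ABC.IUTFork.Conditional.layer5_disch_cor53i_v25_fcirc_descend_injective
  _root_.Summit.ABC.IUTFork.Conditional.layer5_disch_cor53i_v25_fcirc_rigidOverBase_pushCarrier
  _root_.Summit.ABC.IUTFork.Conditional.layer5_disch_cor53i_v25_fcirc_descend_injective_pushCarrier
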